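import Literature.Probability.Process.FWQuasipotential
import Mathlib.Analysis.Calculus.Deriv.Shift
import HarnessLib

/-!
# Freidlin–Wentzell quasipotential: segments, concatenation, triangle inequality

Probability/Process file (sorry-free, no named facts), continuing
`Literature/Probability/Process/FWQuasipotential.lean` (`fwAction`, `IsFWPath`,
`fwQuasipotential`). Elementary path constructions for the quasipotential
`V_b(A, B) = inf { S_{0T}(φ) : φ admissible, φ 0 ∈ A, φ T ∈ B }` of a drift `b`
(Freidlin 1985, §4.1, §4.4; Freidlin–Wentzell, Ch. 4 §2, Ch. 6):

* `segmentPath x y T` — the straight segment from `x` to `y` traversed in time `T`; it is a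
  competitor for continuous `b` (`isFWPath_segmentPath`), with the crude action bound
  `fwAction_segmentPath_le : S_{0T} ≤ ½ T (‖y − x‖ / T + M)²` when `‖b‖ ≤ M` along it; hence
  competitors exist between nonempty sets (`fwActionSet_nonempty`) and **cheap local control**
  (`exists_fwAction_le_of_near`: points near `x₀` are reached from `x₀` at small cost — the
  elementary estimate behind the continuity of `V(O, ·)` in Freidlin–Wentzell, Ch. 4 §2, and
  the step "`I(0, z) → 0` as `z → 0`" in Da Prato–Zabczyk 2014, proof of Thm. 12.25);
* `appendPath T₁ φ₁ φ₂` — concatenation; it stays in the competitor class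
  (`IsFWPath.append`, right derivatives glue with no condition at the junction) and the action
  is additive (`fwAction_append`);
* `fwQuasipotential_triangle : V(A, C) ≤ V(A, {x}) + V({x}, C)` and the path form
  `fwQuasipotential_le_add`.

## References

* M. I. Freidlin, *Functional Integration and Partial Differential Equations*, Annals of Math.
  Studies 109 (1985), §4.1, §4.4. [Freidlin1985]
* M. I. Freidlin, A. D. Wentzell, *Random Perturbations of Dynamical Systems*, 3rd ed.,
  Grundlehren 260 (2012), Ch. 4 §2. [FreidlinWentzell2012]
* G. Da Prato, J. Zabczyk, *Stochastic Equations in Infinite Dimensions*, 2nd ed. (2014),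
  §12.5.3, proof of Thm. 12.25. [DapratoZabczyk2014]
-/

noncomputable section

open MeasureTheory Set Filter intervalIntegral
open scoped Topology Pointwise

namespace Literature.Probability.Process

variable {E : Type*}

section Segment

variable [NormedAddCommGroup E] [NormedSpace ℝ E] {b : E → E} {T : ℝ} {A B : Set E}

/-! #### Straight segments -/

/-- The straight segment from `x` to `y` traversed at constant speed in time `T`:
`t ↦ x + (t/T) • (y − x)`. [folklore] -/
def segmentPath (x y : E) (T : ℝ) : ℝ → E := fun t => x + (t / T) • (y - x)

variable {x y : E}

/-- The segment starts at `x`. [folklore] -/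
@[simp]
theorem segmentPath_zero (x y : E) (T : ℝ) : segmentPath x y T 0 = x := by
  simp [segmentPath]

/-- The segment ends at `y` (for `T ≠ 0`). [folklore] -/
theorem segmentPath_end (x y : E) (hT : T ≠ 0) : segmentPath x y T T = y := by
  simp [segmentPath, div_self hT]

/-- The segment has constant velocity `(1/T) • (y − x)`. [folklore] -/
theorem hasDerivAt_segmentPath (x y : E) (T t : ℝ) :
    HasDerivAt (segmentPath x y T) ((1 / T) • (y - x)) t := by
  have h := ((hasDerivAt_id t).div_const T).smul_const (y - x)
  exact h.const_add x

/-- The segment is continuous. [folklore] -/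
theorem continuous_segmentPath (x y : E) (T : ℝ) : Continuous (segmentPath x y T) :=
  continuous_const.add ((continuous_id.div_const T).smul continuous_const)

/-- Distance travelled along the segment: `‖segmentPath x y T t − x‖ = |t| / |T| · ‖y − x‖`.
[folklore] -/
theorem norm_segmentPath_sub (x y : E) (T t : ℝ) :
    ‖segmentPath x y T t - x‖ = |t| / |T| * ‖y - x‖ := by
  simp [segmentPath, norm_smul]

/-- **Segments are competitors** for a continuous drift. [folklore] -/
theorem isFWPath_segmentPath (hb : Continuous b) (x y : E) (hT : 0 < T) :
    IsFWPath b T (segmentPath x y T) :=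
  IsFWPath.of_hasDerivAt hT (fun t _ => hasDerivAt_segmentPath x y T t)
    (continuous_const.sub (hb.comp (continuous_segmentPath x y T))).continuousOn

/-- **Crude action bound for a segment**: if `‖b‖ ≤ M` along the segment then
`S_{0T} ≤ ½ T (‖y − x‖ / T + M)²`. [folklore] -/
theorem fwAction_segmentPath_le (hT : 0 < T) {M : ℝ}
    (hM : ∀ t ∈ Icc 0 T, ‖b (segmentPath x y T t)‖ ≤ M) :
    fwAction b T (segmentPath x y T) ≤ T / 2 * (‖y - x‖ / T + M) ^ 2 := by
  rw [fwAction_eq_of_hasDerivWithinAt hT.le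
    (fun t _ => (hasDerivAt_segmentPath x y T t).hasDerivWithinAt)]
  have hbound : ∀ t ∈ Set.uIoc (0 : ℝ) T,
      ‖‖(1 / T) • (y - x) - b (segmentPath x y T t)‖ ^ 2‖ ≤ (‖y - x‖ / T + M) ^ 2 := by
    intro t ht
    rw [uIoc_of_le hT.le] at ht
    have hMt := hM t ⟨ht.1.le, ht.2⟩
    rw [Real.norm_of_nonneg (sq_nonneg _)]
    have h1 : ‖(1 / T) • (y - x) - b (segmentPath x y T t)‖ ≤ ‖y - x‖ / T + M := by
      calc ‖(1 / T) • (y - x) - b (segmentPath x y T t)‖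
          ≤ ‖(1 / T) • (y - x)‖ + ‖b (segmentPath x y T t)‖ := norm_sub_le _ _
        _ ≤ ‖y - x‖ / T + M := by
          rw [norm_smul, norm_div, norm_one, Real.norm_of_nonneg hT.le, one_div_mul_eq_div]
          gcongr
    exact pow_le_pow_left₀ (norm_nonneg _) h1 2
  have hI := intervalIntegral.norm_integral_le_of_norm_le_const hbound
  rw [sub_zero, abs_of_pos hT] at hI
  calc (1 / 2) * ∫ t in (0 : ℝ)..T, ‖(1 / T) • (y - x) - b (segmentPath x y T t)‖ ^ 2
      ≤ (1 / 2) * ((‖y - x‖ / T + M) ^ 2 * T) := by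
        gcongr
        exact (Real.le_norm_self _).trans hI
    _ = T / 2 * (‖y - x‖ / T + M) ^ 2 := by ring

/-- **Competitors exist** between nonempty sets when the drift is continuous (a straight
segment traversed in unit time). [folklore] -/
theorem fwActionSet_nonempty (hb : Continuous b) (hA : A.Nonempty) (hB : B.Nonempty) :
    (fwActionSet b A B).Nonempty :=
  let ⟨x, hx⟩ := hA
  let ⟨y, hy⟩ := hB
  ⟨_, mem_fwActionSet (isFWPath_segmentPath hb x y one_pos) (by rwa [segmentPath_zero])
    (by rwa [segmentPath_end x y one_ne_zero])⟩


/-- **Cheap local control**: for a continuous drift, every point `y` close enough to `x₀` is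
reached from `x₀` by an admissible path of action `≤ ε` (the segment from `x₀` to `y` traversed
in a short time). This is the elementary estimate behind the continuity of the quasipotential
(Freidlin–Wentzell, Ch. 4 §2; Da Prato–Zabczyk 2014, proof of Thm. 12.25: `I(0, z) → 0` as
`z → 0`). [folklore] -/
theorem exists_fwAction_le_of_near (hb : Continuous b) (x₀ : E) {ε : ℝ} (hε : 0 < ε) :
    ∃ δ > 0, ∀ y : E, ‖y - x₀‖ < δ → ∃ (T : ℝ) (φ : ℝ → E),
      IsFWPath b T φ ∧ φ 0 = x₀ ∧ φ T = y ∧ fwAction b T φ ≤ ε := by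
  -- a bound `M` for `‖b‖` near `x₀`
  set M := ‖b x₀‖ + 1 with hM_def
  have hM0 : 0 < M := by positivity
  obtain ⟨δ₀, hδ₀, hM⟩ : ∃ δ₀ > 0, ∀ y : E, ‖y - x₀‖ < δ₀ → ‖b y‖ ≤ M := by
    rcases Metric.continuousAt_iff.1 (hb.continuousAt (x := x₀)) 1 one_pos with ⟨δ₀, hδ₀, h⟩
    refine ⟨δ₀, hδ₀, fun y hy => ?_⟩
    have h1 : ‖b y - b x₀‖ < 1 := by
      rw [← dist_eq_norm]
      exact h (by rwa [dist_eq_norm])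
    calc ‖b y‖ = ‖b x₀ + (b y - b x₀)‖ := by rw [add_sub_cancel]
      _ ≤ ‖b x₀‖ + ‖b y - b x₀‖ := norm_add_le _ _
      _ ≤ M := by rw [hM_def]; linarith
  -- the duration / radius `δ`
  set δ := min δ₀ (ε / (M + 1) ^ 2) with hδ_def
  have hδ : 0 < δ := lt_min hδ₀ (by positivity)
  have hδ₁ : δ ≤ δ₀ := min_le_left _ _
  have hδ₂ : δ * (M + 1) ^ 2 ≤ ε := by
    have : δ ≤ ε / (M + 1) ^ 2 := min_le_right _ _
    rwa [le_div_iff₀ (by positivity)] at this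
  refine ⟨δ, hδ, fun y hy => ⟨δ, segmentPath x₀ y δ, isFWPath_segmentPath hb x₀ y hδ,
    segmentPath_zero x₀ y δ, segmentPath_end x₀ y hδ.ne', ?_⟩⟩
  have hseg : ∀ t ∈ Icc 0 δ, ‖b (segmentPath x₀ y δ t)‖ ≤ M := by
    intro t ht
    refine hM _ (lt_of_le_of_lt ?_ (hy.trans_le hδ₁))
    rw [norm_segmentPath_sub, abs_of_nonneg ht.1, abs_of_pos hδ]
    calc t / δ * ‖y - x₀‖ ≤ 1 * ‖y - x₀‖ := by
          gcongr
          rw [div_le_one hδ]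
          exact ht.2
      _ = ‖y - x₀‖ := one_mul _
  have hq : ‖y - x₀‖ / δ ≤ 1 := by
    rw [div_le_one hδ]
    exact hy.le
  calc fwAction b δ (segmentPath x₀ y δ) ≤ δ / 2 * (‖y - x₀‖ / δ + M) ^ 2 :=
        fwAction_segmentPath_le hδ hseg
    _ ≤ δ / 2 * (1 + M) ^ 2 := by gcongr
    _ ≤ ε := by nlinarith [hδ₂, hδ.le]

end Segment

/-! ### Concatenation of paths and the triangle inequality -/

section Append

variable {T₁ T₂ : ℝ} {φ₁ φ₂ : ℝ → E}

/-- **Concatenation**: `φ₁` on `[0, T₁]`, then `φ₂` shifted by `T₁`. [folklore] -/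
def appendPath (T₁ : ℝ) (φ₁ φ₂ : ℝ → E) : ℝ → E := fun t => if t ≤ T₁ then φ₁ t else φ₂ (t - T₁)

/-- Before the junction the concatenation is the first path. [folklore] -/
theorem appendPath_apply_of_le {t : ℝ} (h : t ≤ T₁) : appendPath T₁ φ₁ φ₂ t = φ₁ t :=
  if_pos h

/-- After the junction the concatenation is the shifted second path. [folklore] -/
theorem appendPath_apply_of_lt {t : ℝ} (h : T₁ < t) : appendPath T₁ φ₁ φ₂ t = φ₂ (t - T₁) :=
  if_neg (not_le.2 h)

/-- The concatenation starts where the first path starts (`0 ≤ T₁`). [folklore] -/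
theorem appendPath_zero (hT₁ : 0 ≤ T₁) : appendPath T₁ φ₁ φ₂ 0 = φ₁ 0 :=
  if_pos hT₁

/-- From the junction on, the concatenation of two matching paths is the shifted second path.
[folklore] -/
theorem appendPath_eqOn_Ici (hjoin : φ₁ T₁ = φ₂ 0) :
    EqOn (appendPath T₁ φ₁ φ₂) (fun t => φ₂ (t - T₁)) (Ici T₁) := by
  intro t ht
  rcases (mem_Ici.1 ht).eq_or_lt with rfl | hlt
  · simp [appendPath, hjoin]
  · exact appendPath_apply_of_lt hlt

/-- The concatenation of two matching paths ends where the second path ends (`0 ≤ T₂`).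
[folklore] -/
theorem appendPath_end (hjoin : φ₁ T₁ = φ₂ 0) (hT₂ : 0 ≤ T₂) :
    appendPath T₁ φ₁ φ₂ (T₁ + T₂) = φ₂ T₂ := by
  rw [appendPath_eqOn_Ici hjoin (show T₁ + T₂ ∈ Ici T₁ by simpa using hT₂)]
  simp

variable [NormedAddCommGroup E] [NormedSpace ℝ E] {b : E → E}

/-- Translating the base point of a right derivative. [folklore] -/
theorem derivWithin_Ioi_comp_sub_const (f : ℝ → E) (a t : ℝ) :
    derivWithin (fun s => f (s - a)) (Ioi t) t = derivWithin f (Ioi (t - a)) (t - a) := by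
  rw [derivWithin_comp_sub_const]
  congr 1
  rw [← Set.image_vadd]
  simp only [vadd_eq_add, neg_add_eq_sub, Set.image_sub_const_Ioi]

/-- The action integrand of the concatenation agrees with that of the first path before the
junction. [folklore] -/
theorem appendPath_integrand_eqOn_Iio :
    EqOn (fun t => ‖derivWithin (appendPath T₁ φ₁ φ₂) (Ioi t) t - b (appendPath T₁ φ₁ φ₂ t)‖ ^ 2)
      (fun t => ‖derivWithin φ₁ (Ioi t) t - b (φ₁ t)‖ ^ 2) (Iio T₁) := by
  intro t ht
  have hlt : t < T₁ := ht
  have hev : appendPath T₁ φ₁ φ₂ =ᶠ[𝓝[Ioi t] t] φ₁ := by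
    filter_upwards [Ioo_mem_nhdsGT hlt] with s hs using appendPath_apply_of_le hs.2.le
  simp only
  rw [hev.derivWithin_eq (appendPath_apply_of_le hlt.le), appendPath_apply_of_le hlt.le]

/-- The action integrand of the concatenation of two matching paths agrees, from the junction
on, with the shifted integrand of the second path. [folklore] -/
theorem appendPath_integrand_eqOn_Ici (hjoin : φ₁ T₁ = φ₂ 0) :
    EqOn (fun t => ‖derivWithin (appendPath T₁ φ₁ φ₂) (Ioi t) t - b (appendPath T₁ φ₁ φ₂ t)‖ ^ 2)
      (fun t => ‖derivWithin φ₂ (Ioi (t - T₁)) (t - T₁) - b (φ₂ (t - T₁))‖ ^ 2) (Ici T₁) := by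
  intro t ht
  have hge : T₁ ≤ t := ht
  have heq := appendPath_eqOn_Ici hjoin (φ₁ := φ₁)
  have hs : EqOn (appendPath T₁ φ₁ φ₂) (fun s => φ₂ (s - T₁)) (Ioi t) :=
    fun s hs => heq (hge.trans (le_of_lt hs))
  simp only
  rw [derivWithin_congr hs (heq ht), derivWithin_Ioi_comp_sub_const, heq ht]

/-- **Concatenation stays in the competitor class**: if `φ₁` is admissible on `[0, T₁]`, `φ₂`
on `[0, T₂]`, and `φ₁ T₁ = φ₂ 0`, then their concatenation is admissible on `[0, T₁ + T₂]`
(right derivatives glue without any condition at the junction). [folklore] -/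
theorem IsFWPath.append (h₁ : IsFWPath b T₁ φ₁) (h₂ : IsFWPath b T₂ φ₂) (hjoin : φ₁ T₁ = φ₂ 0) :
    IsFWPath b (T₁ + T₂) (appendPath T₁ φ₁ φ₂) := by
  have hT₁ := h₁.pos
  have hT₂ := h₂.pos
  have heq₁ : EqOn (appendPath T₁ φ₁ φ₂) φ₁ (Iic T₁) := fun t ht => appendPath_apply_of_le ht
  have heq₂ := appendPath_eqOn_Ici hjoin (φ₁ := φ₁)
  refine ⟨by linarith, ?_, ?_, ?_⟩
  · have hc₁ : ContinuousOn (appendPath T₁ φ₁ φ₂) (Icc 0 T₁) :=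
      h₁.continuousOn.congr fun t ht => heq₁ ht.2
    have hc₂ : ContinuousOn (appendPath T₁ φ₁ φ₂) (Icc T₁ (T₁ + T₂)) := by
      have : ContinuousOn (fun t => φ₂ (t - T₁)) (Icc T₁ (T₁ + T₂)) :=
        h₂.continuousOn.comp (continuousOn_id.sub continuousOn_const)
          fun t ht => ⟨by linarith [ht.1], by linarith [ht.2]⟩
      exact this.congr fun t ht => heq₂ ht.1
    have := hc₁.union_of_isClosed hc₂ isClosed_Icc isClosed_Icc
    rwa [Icc_union_Icc_eq_Icc (by linarith) (by linarith)] at this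
  · intro t ht
    rcases lt_or_ge t T₁ with hlt | hge
    · refine (h₁.differentiableWithinAt t ⟨ht.1, hlt⟩).congr_of_eventuallyEq ?_ (heq₁ hlt.le)
      filter_upwards [Ioo_mem_nhdsGT hlt] with s hs using heq₁ hs.2.le
    · have hd := h₂.differentiableWithinAt (t - T₁) ⟨by linarith, by linarith [ht.2]⟩
      have hd' : DifferentiableWithinAt ℝ (fun s => φ₂ (s - T₁)) (Ioi t) t :=
        hd.comp t (differentiableWithinAt_id.sub_const T₁) fun s hs => sub_lt_sub_right hs T₁
      exact hd'.congr (fun s hs => heq₂ (hge.trans (le_of_lt hs))) (heq₂ hge)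
  · refine IntervalIntegrable.trans (b := T₁) ?_ ?_
    · exact intervalIntegrable_congr_Ioo hT₁.le
        (fun t ht => (appendPath_integrand_eqOn_Iio (b := b) (φ₂ := φ₂) ht.2).symm)
        h₁.intervalIntegrable
    · have hI := h₂.intervalIntegrable.comp_sub_right T₁
      rw [zero_add, add_comm T₂] at hI
      exact intervalIntegrable_congr_Ioo (by linarith)
        (fun t ht => (appendPath_integrand_eqOn_Ici (b := b) hjoin ht.1.le).symm) hI

/-- **The action is additive under concatenation.** [folklore] -/
theorem fwAction_append (h₁ : IsFWPath b T₁ φ₁) (h₂ : IsFWPath b T₂ φ₂) (hjoin : φ₁ T₁ = φ₂ 0) :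
    fwAction b (T₁ + T₂) (appendPath T₁ φ₁ φ₂) = fwAction b T₁ φ₁ + fwAction b T₂ φ₂ := by
  have hT₁ := h₁.pos
  have hT₂ := h₂.pos
  have h := h₁.append h₂ hjoin
  unfold fwAction
  rw [← mul_add]
  congr 1
  have hi₁ : IntervalIntegrable (fun t => ‖derivWithin (appendPath T₁ φ₁ φ₂) (Ioi t) t -
      b (appendPath T₁ φ₁ φ₂ t)‖ ^ 2) volume 0 T₁ :=
    h.intervalIntegrable.mono_set (by
      rw [uIcc_of_le hT₁.le, uIcc_of_le (by linarith : (0 : ℝ) ≤ T₁ + T₂)]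
      exact Icc_subset_Icc le_rfl (by linarith))
  have hi₂ : IntervalIntegrable (fun t => ‖derivWithin (appendPath T₁ φ₁ φ₂) (Ioi t) t -
      b (appendPath T₁ φ₁ φ₂ t)‖ ^ 2) volume T₁ (T₁ + T₂) :=
    h.intervalIntegrable.mono_set (by
      rw [uIcc_of_le (by linarith : T₁ ≤ T₁ + T₂), uIcc_of_le (by linarith : (0 : ℝ) ≤ T₁ + T₂)]
      exact Icc_subset_Icc hT₁.le le_rfl)
  rw [← integral_add_adjacent_intervals hi₁ hi₂]
  congr 1
  · exact intervalIntegral_congr_Ioo hT₁.le fun t ht => appendPath_integrand_eqOn_Iio ht.2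
  · rw [intervalIntegral_congr_Ioo (by linarith) fun t ht =>
        appendPath_integrand_eqOn_Ici (b := b) hjoin ht.1.le,
      intervalIntegral.integral_comp_sub_right
        (fun t => ‖derivWithin φ₂ (Ioi t) t - b (φ₂ t)‖ ^ 2) T₁]
    simp

variable {A C : Set E}

/-- **Triangle inequality** `V(A, C) ≤ V(A, {x}) + V({x}, C)`: concatenate near-optimal paths
through `x` (both problems on the right must have competitors, else their values are the junk
`0`). For points this is `V(x, z) ≤ V(x, y) + V(y, z)` (Freidlin–Wentzell, Ch. 4 §2 / Ch. 6;
Da Prato–Zabczyk 2014, proof of Thm. 12.25: `I_T(0, a) = I_T(0, z) + I_T(z, a)` along a path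
through `z`). [folklore] -/
theorem fwQuasipotential_triangle (x : E) (h₁ : (fwActionSet b A {x}).Nonempty)
    (h₂ : (fwActionSet b {x} C).Nonempty) :
    fwQuasipotential b A C ≤ fwQuasipotential b A {x} + fwQuasipotential b {x} C := by
  refine le_of_forall_pos_lt_add fun ε hε => ?_
  obtain ⟨T₁, φ₁, hp₁, hA, hx₁, hlt₁⟩ :=
    exists_fwAction_lt h₁ (lt_add_of_pos_right (fwQuasipotential b A {x}) (half_pos hε))
  obtain ⟨T₂, φ₂, hp₂, hx₂, hC, hlt₂⟩ :=
    exists_fwAction_lt h₂ (lt_add_of_pos_right (fwQuasipotential b {x} C) (half_pos hε))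
  have hjoin : φ₁ T₁ = φ₂ 0 := by
    rw [mem_singleton_iff.1 hx₁, mem_singleton_iff.1 hx₂]
  calc fwQuasipotential b A C ≤ fwAction b (T₁ + T₂) (appendPath T₁ φ₁ φ₂) :=
        fwQuasipotential_le (hp₁.append hp₂ hjoin) (by rwa [appendPath_zero hp₁.pos.le])
          (by rwa [appendPath_end hjoin hp₂.pos.le])
    _ = fwAction b T₁ φ₁ + fwAction b T₂ φ₂ := fwAction_append hp₁ hp₂ hjoin
    _ < fwQuasipotential b A {x} + fwQuasipotential b {x} C + ε := by linarith

/-- **Upper bound by a path through an intermediate point**: an admissible path from `A` to `x`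
followed by one from `x` to `C` bounds `V(A, C)` by the sum of the actions. [folklore] -/
theorem fwQuasipotential_le_add (h₁ : IsFWPath b T₁ φ₁) (h₂ : IsFWPath b T₂ φ₂)
    (hjoin : φ₁ T₁ = φ₂ 0) (hA : φ₁ 0 ∈ A) (hC : φ₂ T₂ ∈ C) :
    fwQuasipotential b A C ≤ fwAction b T₁ φ₁ + fwAction b T₂ φ₂ := by
  rw [← fwAction_append h₁ h₂ hjoin]
  exact fwQuasipotential_le (h₁.append h₂ hjoin) (by rwa [appendPath_zero h₁.pos.le])
    (by rwa [appendPath_end hjoin h₂.pos.le])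

end Append

end Literature.Probability.Process
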